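import Literature.NumberTheory.EllipticCurves.HalfIntegralWeightFormsProofs
import Literature.NumberTheory.EllipticCurves.HalfIntegralWeightThetaMultiplier
import HarnessLib

/-!
# Crux `PrintCFram.BottomClassIndexLawFiveLe` (stmt-BirchSwinnertonDyer-20372), line `eisenstein-resource-bdp-line` (registry v29 `stub_flipRungs.2`):
# THE 2-ADIC FLIPPED-CUSP RUNG, piece P4a — `θ` AT THE ODD CUSP `a/M′` READ THROUGH `γ₀ = [[a,b],[M′,64]]`: A SERIES IN `e(z/4)`
# (cell `bsd-print-cfram`, width seat `bsd-line-cfram-p1-w7` g8; THEOREMS ONLY, `--supports` 20372 `--as helper`; BSD is not proved by any of this)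

HONEST FRAMING. Nothing here is a statement about BSD; no registered stub is closed. First half of piece P4 of the kernel typing of (RungTwo⁶)
(crux notes `Lines/eisenstein-resource-bdp-line-w7g8-T6.md` §5c–§5d): the theta factor of the Katz vehicle `V = (P_c g)·θ` at the flipped cusp.
The tree's Poisson-summation transformation law `shimuraTheta_smul_eq_tsum` (`Literature/…/HalfIntegralWeightThetaTransformation`, ★) specialised to
`γ₀ = [[a,b],[M′,64]] ∈ SL₂(ℤ)` (`M′ ≥ 1` odd; the cusp `a/M′` of the 2-adic rung): for every `z ∈ ℍ`,
`θ(γ₀•z) = (2iM′/(M′z+64))^{−1/2} · Σ_{k∈ℤ} e(16k²/M′)·G(a,k;M′) · e(k²z/4)`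
— a series in `e(z/4)` whose coefficients `e(16k²/M′)G(a,k;M′)` are algebraic integers and whose constant term is the quadratic Gauss sum
`G(a;M′)` (`|G(a;M′)|² = M′`, a unit away from `M′`): this is the `Θ` of w3 g19's transport shape `F ∣ γ = Θ·B` (`…FlipRungTransport`), and at
`z = 64•w` the exponentials are `e(16k²w)` while `M′z + 64 = 64(M′w+1)` is `8·` the common base `8(M′w+1)` of P1/P3.

* `cexp_thetaPhase_split` — `exp(πi k²(M′z+64)/(2M′)) = e(16k²/M′)·e(k²z/4)` (`M′ ≠ 0`);
* **`shimuraTheta_flippedCusp_eq_tsum`** — the displayed identity; `shimuraTheta_flippedCusp_dilate_eq_tsum` — the same at `z = 64•w`.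

No definitions, no named facts, no `sorry`. beyond-print theorem: NO. References: [Shimura1973HalfIntegral] §1; [KoblitzECMF1993] III §3, IV §1;
crux notes w7g8-T6 §5d P4.
-/

set_option autoImplicit false
-- summit-side namespace `Summit.BirchSwinnertonDyer.BirchSwinnertonDyer.…` (single-conjunct summit, D-0017 layout)
set_option linter.dupNamespace false

noncomputable section

open Complex
open UpperHalfPlane hiding I
open scoped MatrixGroups Real
open Literature.NumberTheory.EllipticCurves.ModularForms

namespace Summit.BirchSwinnertonDyer.BirchSwinnertonDyer.Theorems.PrintCFram.FlipRung

/-- The phase of the `k`-th term at the cusp `a/M′`: `exp(πi k²(M′z+64)/(2M′)) = e(16k²/M′)·e(k²z/4)`. [folklore] -/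
theorem cexp_thetaPhase_split {M : ℕ} (hM : M ≠ 0) (k : ℤ) (z : ℂ) :
    cexp (Real.pi * I * (k : ℂ) ^ 2 * (((M : ℂ) * z + 64) / (2 * (M : ℂ)))) =
      cexp (2 * Real.pi * I * (16 * (k : ℂ) ^ 2) / (M : ℂ)) * cexp (2 * Real.pi * I * ((k : ℂ) ^ 2 * z) / 4) := by
  have hMC : (M : ℂ) ≠ 0 := by exact_mod_cast hM
  rw [← Complex.exp_add]
  congr 1
  field_simp
  ring

/-- **`θ` AT THE ODD CUSP `a/M′`**: for `γ₀ = [[a,b],[M′,64]] ∈ SL₂(ℤ)` (`M′ ≥ 1`) and `z ∈ ℍ`,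
`θ(γ₀•z) = (2iM′/(M′z+64))^{−1/2}·Σ_{k∈ℤ} (e(16k²/M′)·G(a,k;M′))·e(k²z/4)` (the tree's Poisson-summation law `shimuraTheta_smul_eq_tsum` with
`c = M′`, `d = 64`). [cite: Shimura1973HalfIntegral, §1] [cite: KoblitzECMF1993, Ch. III §3] -/
theorem shimuraTheta_flippedCusp_eq_tsum {M : ℕ} [NeZero M] (γ₀ : SL(2, ℤ)) {a : ℤ}
    (h00 : (γ₀ 0 0 : ℤ) = a) (h10 : (γ₀ 1 0 : ℤ) = M) (h11 : (γ₀ 1 1 : ℤ) = 64) (z : ℍ) :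
    shimuraTheta (γ₀ • z) =
      1 / (2 * I * (M : ℂ) / ((M : ℂ) * z + 64)) ^ (1 / 2 : ℂ) *
        ∑' k : ℤ, (cexp (2 * Real.pi * I * (16 * (k : ℂ) ^ 2) / (M : ℂ)) * quadGaussSum M (a : ZMod M) (k : ZMod M)) *
          cexp (2 * Real.pi * I * ((k : ℂ) ^ 2 * z) / 4) := by
  have hM : M ≠ 0 := NeZero.ne M
  rw [shimuraTheta_smul_eq_tsum (c := M) h10 z, h11, h00]
  push_cast
  congr 1
  refine tsum_congr (fun k => ?_)
  rw [cexp_thetaPhase_split hM k z]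
  ring

/-- The same at the dilated point `z = 64•w` of the flipped cusp `W = γ₀·diag(64,1)`: `M′z + 64 = 64(M′w+1)` and `e(k²z/4) = e(16k²w)`.
[cite: Shimura1973HalfIntegral, §1] -/
theorem shimuraTheta_flippedCusp_dilate_eq_tsum {M : ℕ} [NeZero M] (γ₀ : SL(2, ℤ)) {a : ℤ}
    (h00 : (γ₀ 0 0 : ℤ) = a) (h10 : (γ₀ 1 0 : ℤ) = M) (h11 : (γ₀ 1 1 : ℤ) = 64) (w : ℍ) :
    shimuraTheta (γ₀ • ((⟨64, by norm_num⟩ : {x : ℝ // 0 < x}) • w)) =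
      1 / (2 * I * (M : ℂ) / (64 * ((M : ℂ) * w + 1))) ^ (1 / 2 : ℂ) *
        ∑' k : ℤ, (cexp (2 * Real.pi * I * (16 * (k : ℂ) ^ 2) / (M : ℂ)) * quadGaussSum M (a : ZMod M) (k : ZMod M)) *
          cexp (2 * Real.pi * I * (16 * (k : ℂ) ^ 2 * w)) := by
  rw [shimuraTheta_flippedCusp_eq_tsum γ₀ h00 h10 h11, coe_pos_real_smul]
  simp only [Complex.real_smul]
  push_cast
  have e1 : (M : ℂ) * (64 * (w : ℂ)) + 64 = 64 * ((M : ℂ) * w + 1) := by ring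
  rw [e1]
  congr 1
  refine tsum_congr (fun k => ?_)
  congr 2
  ring

end Summit.BirchSwinnertonDyer.BirchSwinnertonDyer.Theorems.PrintCFram.FlipRung

end
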